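import Literature.Analysis.FunctionSpaces.LatticeConvolutionAlgebra
import Mathlib.Analysis.InnerProductSpace.Adjoint
import Mathlib.Analysis.MeanInequalities
import HarnessLib

/-!
# The `H_0` pairing on the lattice, Cauchy–Schwarz `|⟨u,v⟩| ≤ ‖u‖_s ‖v‖_{-s}`, and formal adjoints
# (Warner 6.18 (e), (f), 6.24 (5))

Continuation of the lattice Sobolev calculus. For coefficient families with values in a complex
Hilbert space `V`, the `H_0` pairing

  `⟨u, v⟩ = ∑_k ⟪u k, v k⟫`      (`Lattice.pairing u v`; conjugate-linear in `u`)

is the Fourier side of the `L²` inner product of functions on `T^d` (Parseval). F. W. Warner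
(GTM 94 (1983), 6.18 (e)): `|⟨u, v⟩_0| ≤ ‖u‖_{t} ‖v‖_{-t}` ("Schwartz inequality"), and the formal
adjoint of a periodic differential operator (6.24 (5): `⟨Lφ, ψ⟩ = ⟨φ, L*ψ⟩`, and 6.31 (2): the same
for `u ∈ H_s` against test functions).

## Contents (all proved)

* `Lattice.pairing`, absolute convergence and the bound `‖⟨u, v⟩‖ ≤ ‖u‖_s ‖v‖_{-s}`
  (`Lattice.norm_pairing_le`, weighted Cauchy–Schwarz), sesquilinearity;
* testing against single modes `Pi.single k e`: a family all of whose pairings with rapidly decreasing families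
  vanish is zero (`Lattice.eq_zero_of_forall_pairing_eq_zero`);
* the **adjoint of a multiplier**: `⟨a ⋆ u, v⟩ = ⟨u, a† ⋆ v⟩` with `a†(k) = (a(-k))†`
  (`Lattice.pairing_conv_left`, Fubini; for the coefficients of a matrix function `ω` this is the
  pointwise adjoint `ω(x)†`), and of a derivative: `⟨∂_j u, v⟩ = -⟨u, ∂_j v⟩`
  (`Lattice.pairing_freqDeriv_left`).

The formal adjoint of a `Lattice.POp` is assembled from these in `LatticeDiffOpAdjoint.lean`.

## References

* F. W. Warner, *Foundations of Differentiable Manifolds and Lie Groups*, GTM 94 (1983), 6.18 (e),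
  6.24 (5), 6.31 (2). [WarnerGTM94]
-/

open Filter Finset
open scoped ENNReal NNReal Topology InnerProductSpace ComplexConjugate

noncomputable section

namespace Literature.Analysis.FunctionSpaces

namespace Lattice

open Torus

variable {d : Type*} [Fintype d]
variable {V W : Type*} [NormedAddCommGroup V] [InnerProductSpace ℂ V] [NormedAddCommGroup W]
  [InnerProductSpace ℂ W]

/-! ### The pairing and its convergence -/

/-- The **`H_0` pairing** `⟨u, v⟩ = ∑_k ⟪u k, v k⟫` of two coefficient families (conjugate-linear
in `u`, linear in `v`, Mathlib's convention for `inner`); the Fourier side of `∫ ⟪f, g⟫` on `T^d`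
(Warner 6.17 (3) with `s = 0`). Junk value `0` when the sum diverges. [cite: WarnerGTM94, 6.17 (3)] -/
def pairing (u v : (d → ℤ) → V) : ℂ := ∑' k, ⟪u k, v k⟫_ℂ

/-- **Weighted Cauchy–Schwarz** (Warner 6.18 (e)): for `u ∈ H_s`, `v ∈ H_{-s}` (with values in any
normed groups) `∑ ‖u k‖ ‖v k‖ ≤ ‖u‖_s ‖v‖_{-s} < ∞`. [cite: WarnerGTM94, 6.18 (e)] -/
theorem summable_norm_mul_norm {X Y : Type*} [NormedAddCommGroup X] [NormedAddCommGroup Y] {s : ℝ}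
    {u : (d → ℤ) → X} {v : (d → ℤ) → Y} (hu : eNormSq s u < ∞) (hv : eNormSq (-s) v < ∞) :
    Summable (fun k => ‖u k‖ * ‖v k‖) ∧
      ∑' k, ‖u k‖ * ‖v k‖ ≤ (eNorm s u).toReal * (eNorm (-s) v).toReal := by
  -- `‖u k‖‖v k‖ = (w_s ‖u k‖)(w_{-s} ‖v k‖)`
  obtain ⟨f, hf⟩ : ∃ f : (d → ℤ) → ℝ, ∀ k, f k = sobolevWeight s k * ‖u k‖ := ⟨_, fun _ => rfl⟩
  obtain ⟨g, hg⟩ : ∃ g : (d → ℤ) → ℝ, ∀ k, g k = sobolevWeight (-s) k * ‖v k‖ := ⟨_, fun _ => rfl⟩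
  have hfg : ∀ k, ‖u k‖ * ‖v k‖ = f k * g k := fun k => by
    rw [hf, hg]
    have := sobolevWeight_neg_mul_sobolevWeight s k
    calc ‖u k‖ * ‖v k‖ = (sobolevWeight (-s) k * sobolevWeight s k) * (‖u k‖ * ‖v k‖) := by rw [this, one_mul]
      _ = _ := by ring
  have hf0 : ∀ k, 0 ≤ f k := fun k => by rw [hf]; exact mul_nonneg (sobolevWeight_pos s k).le (norm_nonneg _)
  have hg0 : ∀ k, 0 ≤ g k := fun k => by rw [hg]; exact mul_nonneg (sobolevWeight_pos (-s) k).le (norm_nonneg _)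
  have hf2 : Summable fun k => f k ^ (2 : ℝ) :=
    (summable_of_eNormSq_lt_top hu).congr fun k => by rw [hf, Real.rpow_two, mul_pow]
  have hg2 : Summable fun k => g k ^ (2 : ℝ) :=
    (summable_of_eNormSq_lt_top hv).congr fun k => by rw [hg, Real.rpow_two, mul_pow]
  have hH := Real.HolderConjugate.two_two
  refine ⟨(Real.summable_mul_of_Lp_Lq_of_nonneg hH hf0 hg0 hf2 hg2).congr fun k => (hfg k).symm, ?_⟩
  have hb := Real.inner_le_Lp_mul_Lq_tsum_of_nonneg hH hf0 hg0 hf2 hg2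
  simp only [← hfg] at hb
  refine hb.trans (le_of_eq ?_)
  -- identify the two factors with the `eNorm`s
  have h1 : (∑' k, f k ^ (2 : ℝ)) = (eNormSq s u).toReal := by
    rw [eNormSq, ENNReal.tsum_toReal_eq (fun _ => ENNReal.mul_ne_top ENNReal.ofReal_ne_top (ENNReal.pow_ne_top enorm_ne_top))]
    exact tsum_congr fun k => by rw [toReal_term, hf, Real.rpow_two, mul_pow]
  have h2 : (∑' k, g k ^ (2 : ℝ)) = (eNormSq (-s) v).toReal := by
    rw [eNormSq, ENNReal.tsum_toReal_eq (fun _ => ENNReal.mul_ne_top ENNReal.ofReal_ne_top (ENNReal.pow_ne_top enorm_ne_top))]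
    exact tsum_congr fun k => by rw [toReal_term, hg, Real.rpow_two, mul_pow]
  rw [h1, h2, eNorm, eNorm, ← ENNReal.toReal_rpow, ← ENNReal.toReal_rpow]

/-- The terms of the pairing are absolutely summable for `u ∈ H_s`, `v ∈ H_{-s}`. [cite: WarnerGTM94, 6.18 (e)] -/
theorem summable_inner {s : ℝ} {u v : (d → ℤ) → V} (hu : eNormSq s u < ∞) (hv : eNormSq (-s) v < ∞) :
    Summable fun k => ⟪u k, v k⟫_ℂ :=
  Summable.of_norm_bounded (summable_norm_mul_norm hu hv).1 fun _ => norm_inner_le_norm _ _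

/-- The pairing is the sum of its series. [folklore] -/
theorem hasSum_pairing {s : ℝ} {u v : (d → ℤ) → V} (hu : eNormSq s u < ∞) (hv : eNormSq (-s) v < ∞) :
    HasSum (fun k => ⟪u k, v k⟫_ℂ) (pairing u v) :=
  (summable_inner hu hv).hasSum

/-- **Warner 6.18 (e)**: `‖⟨u, v⟩‖ ≤ ‖u‖_s ‖v‖_{-s}`. [cite: WarnerGTM94, 6.18 (e)] -/
theorem norm_pairing_le {s : ℝ} {u v : (d → ℤ) → V} (hu : eNormSq s u < ∞) (hv : eNormSq (-s) v < ∞) :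
    ‖pairing u v‖ ≤ (eNorm s u).toReal * (eNorm (-s) v).toReal := by
  obtain ⟨hsum, hle⟩ := summable_norm_mul_norm hu hv
  refine (norm_tsum_le_tsum_norm (summable_inner hu hv).norm).trans (le_trans ?_ hle)
  exact ((summable_inner hu hv).norm).tsum_le_tsum (fun k => norm_inner_le_norm _ _) hsum

/-- Rapidly decreasing against tempered: the pairing converges (choose `s` with `u ∈ H_s`; a rapidly
decreasing family lies in every `H_{-s}`). [folklore] -/
theorem summable_inner_of_tempered_rapidDecay {u v : (d → ℤ) → V} (hu : Tempered u) (hv : RapidDecay v) :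
    Summable fun k => ⟪u k, v k⟫_ℂ := by
  obtain ⟨s, hs⟩ := hu
  exact summable_inner hs (eNormSq_lt_top_of_rapidDecay hv (-s))

/-- Tempered against rapidly decreasing, the other way round. [folklore] -/
theorem summable_inner_of_rapidDecay_tempered {u v : (d → ℤ) → V} (hu : RapidDecay u) (hv : Tempered v) :
    Summable fun k => ⟪u k, v k⟫_ℂ := by
  obtain ⟨s, hs⟩ := hv
  exact summable_inner (eNormSq_lt_top_of_rapidDecay hu (-s)) (by rwa [neg_neg])

/-! ### Sesquilinearity -/

omit [Fintype d] in
/-- `⟨v, u⟩ = conj ⟨u, v⟩` (unconditionally). [folklore] -/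
theorem pairing_comm (u v : (d → ℤ) → V) : pairing v u = conj (pairing u v) := by
  rw [pairing, pairing, Complex.conj_tsum]
  exact tsum_congr fun k => (inner_conj_symm _ _).symm

omit [Fintype d] in
/-- `⟨u, z • v⟩ = z ⟨u, v⟩` (unconditionally). [folklore] -/
theorem pairing_smul_right (u v : (d → ℤ) → V) (z : ℂ) : pairing u (z • v) = z * pairing u v := by
  rw [pairing, pairing, ← tsum_mul_left]
  exact tsum_congr fun k => by rw [Pi.smul_apply, inner_smul_right]

omit [Fintype d] in
/-- `⟨z • u, v⟩ = conj z ⟨u, v⟩` (unconditionally). [folklore] -/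
theorem pairing_smul_left (u v : (d → ℤ) → V) (z : ℂ) : pairing (z • u) v = conj z * pairing u v := by
  rw [pairing, pairing, ← tsum_mul_left]
  exact tsum_congr fun k => by rw [Pi.smul_apply, inner_smul_left]

omit [Fintype d] in
/-- Additivity in the right slot, given convergence. [folklore] -/
theorem pairing_add_right {u v v' : (d → ℤ) → V} (hv : Summable fun k => ⟪u k, v k⟫_ℂ)
    (hv' : Summable fun k => ⟪u k, v' k⟫_ℂ) : pairing u (v + v') = pairing u v + pairing u v' := by
  rw [pairing, pairing, pairing, ← hv.tsum_add hv']
  exact tsum_congr fun k => by rw [Pi.add_apply, inner_add_right]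

omit [Fintype d] in
/-- Additivity in the left slot, given convergence. [folklore] -/
theorem pairing_add_left {u u' v : (d → ℤ) → V} (hu : Summable fun k => ⟪u k, v k⟫_ℂ)
    (hu' : Summable fun k => ⟪u' k, v k⟫_ℂ) : pairing (u + u') v = pairing u v + pairing u' v := by
  rw [pairing, pairing, pairing, ← hu.tsum_add hu']
  exact tsum_congr fun k => by rw [Pi.add_apply, inner_add_left]

omit [Fintype d] in
/-- Subtraction in the right slot, given convergence. [folklore] -/
theorem pairing_sub_right {u v v' : (d → ℤ) → V} (hv : Summable fun k => ⟪u k, v k⟫_ℂ)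
    (hv' : Summable fun k => ⟪u k, v' k⟫_ℂ) : pairing u (v - v') = pairing u v - pairing u v' := by
  rw [pairing, pairing, pairing, ← hv.tsum_sub hv']
  exact tsum_congr fun k => by rw [Pi.sub_apply, inner_sub_right]

omit [Fintype d] in
/-- Subtraction in the left slot, given convergence. [folklore] -/
theorem pairing_sub_left {u u' v : (d → ℤ) → V} (hu : Summable fun k => ⟪u k, v k⟫_ℂ)
    (hu' : Summable fun k => ⟪u' k, v k⟫_ℂ) : pairing (u - u') v = pairing u v - pairing u' v := by
  rw [pairing, pairing, pairing, ← hu.tsum_sub hu']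
  exact tsum_congr fun k => by rw [Pi.sub_apply, inner_sub_left]

/-! ### Testing against single modes (`Pi.single k₀ e = δ_{k₀} e`) -/

omit [InnerProductSpace ℂ V] in
/-- Single modes `Pi.single k₀ e` (the mode `δ_{k₀} e`) are rapidly decreasing. [folklore] -/
theorem rapidDecay_single (k₀ : d → ℤ) (e : V) : RapidDecay (Pi.single k₀ e : (d → ℤ) → V) := fun m =>
  summable_of_ne_finset_zero (s := {k₀}) fun k hk => by
    have : k ≠ k₀ := by simpa using hk
    simp [Pi.single_eq_of_ne this]

/-- Pairing against a single mode picks one coefficient: `⟨u, δ_{k₀} e⟩ = ⟪u k₀, e⟫`. [folklore] -/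
theorem pairing_single_right (u : (d → ℤ) → V) (k₀ : d → ℤ) (e : V) :
    pairing u (Pi.single k₀ e) = ⟪u k₀, e⟫_ℂ := by
  rw [pairing, tsum_eq_single k₀]
  · simp
  · intro k hk; simp [Pi.single_eq_of_ne hk]

/-- Pairing a single mode on the left: `⟨δ_{k₀} e, v⟩ = ⟪e, v k₀⟫`. [folklore] -/
theorem pairing_single_left (k₀ : d → ℤ) (e : V) (v : (d → ℤ) → V) :
    pairing (Pi.single k₀ e) v = ⟪e, v k₀⟫_ℂ := by
  rw [pairing, tsum_eq_single k₀]
  · simp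
  · intro k hk; simp [Pi.single_eq_of_ne hk]

/-- **A family is determined by its pairings with rapidly decreasing families** (test against the
single modes `δ_k (u k)`): `(∀ v rapidly decreasing, ⟨u, v⟩ = 0) ⇒ u = 0`. This is how Warner's
"equal on `V`" (6.31 (3)) and 6.18 (f) are used. [cite: WarnerGTM94, 6.18 (f)] -/
theorem eq_zero_of_forall_pairing_eq_zero {u : (d → ℤ) → V}
    (h : ∀ v : (d → ℤ) → V, RapidDecay v → pairing u v = 0) : u = 0 := by
  funext k
  have := h (Pi.single k (u k)) (rapidDecay_single k (u k))
  rw [pairing_single_right, inner_self_eq_zero] at this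
  exact this

/-- The same with the test families on the left. [cite: WarnerGTM94, 6.18 (f)] -/
theorem eq_zero_of_forall_pairing_eq_zero_left {v : (d → ℤ) → V}
    (h : ∀ u : (d → ℤ) → V, RapidDecay u → pairing u v = 0) : v = 0 := by
  funext k
  have := h (Pi.single k (v k)) (rapidDecay_single k (v k))
  rw [pairing_single_left, inner_self_eq_zero] at this
  exact this

/-! ### Sums inside the inner product; convolution-dominated real families -/

/-- `⟪x, ∑_l w_l⟫ = ∑_l ⟪x, w_l⟫` for a summable family (second slot). [folklore] -/
theorem inner_tsum_right {ι : Type*} (x : W) {w : ι → W} (hw : Summable w) :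
    ⟪x, ∑' l, w l⟫_ℂ = ∑' l, ⟪x, w l⟫_ℂ :=
  (innerSL ℂ x).map_tsum hw

/-- `⟪∑_l w_l, x⟫ = ∑_l ⟪w_l, x⟫` for a summable family (first slot). [folklore] -/
theorem inner_tsum_left {ι : Type*} {w : ι → W} (hw : Summable w) (x : W) :
    ⟪∑' l, w l, x⟫_ℂ = ∑' l, ⟪w l, x⟫_ℂ := by
  rw [← inner_conj_symm, inner_tsum_right x hw, Complex.conj_tsum]
  exact tsum_congr fun l => inner_conj_symm _ _

/-- `∑_l ‖a(k-l)‖ ‖u l‖ < ∞` for rapidly decreasing `a` and `u ∈ H_s` (weight bound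
`‖u l‖ ≤ ⟨l⟩^{-s}‖u‖_s` and `Lattice.summable_norm_symbol_mul_weight`). [folklore] -/
theorem summable_norm_mul_norm_apply {a : (d → ℤ) → (V →L[ℂ] W)} (ha : RapidDecay a) {s : ℝ}
    {u : (d → ℤ) → V} (hu : eNormSq s u < ∞) (k : d → ℤ) : Summable fun l => ‖a (k - l)‖ * ‖u l‖ :=
  ((summable_norm_symbol_mul_weight ha (-s) k).mul_left ((eNorm s u).toReal)).of_nonneg_of_le
    (fun l => by positivity) fun l => by
      calc ‖a (k - l)‖ * ‖u l‖ ≤ ‖a (k - l)‖ * (sobolevWeight (-s) l * (eNorm s u).toReal) := by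
            gcongr; exact norm_apply_le_of_eNormSq_lt_top hu l
        _ = (eNorm s u).toReal * (‖a (k - l)‖ * sobolevWeight (-s) l) := by ring

/-- The real family `N(k) = ∑_l ‖a(k-l)‖ ‖u l‖` is convolution-dominated, hence in `H_s` with `u`.
[folklore] -/
theorem eNormSq_tsum_norm_mul_norm_lt_top {a : (d → ℤ) → (V →L[ℂ] W)} (ha : RapidDecay a) {s : ℝ}
    {u : (d → ℤ) → V} (hu : eNormSq s u < ∞) :
    eNormSq s (fun k => (∑' l, ‖a (k - l)‖ * ‖u l‖ : ℝ)) < ∞ := by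
  refine (eNormSq_le_of_enorm_le_conv s a u (fun k => ?_)).trans_lt
    (ENNReal.mul_lt_top (ENNReal.mul_lt_top ENNReal.ofReal_lt_top
      (ENNReal.pow_lt_top (symbNorm_lt_top_of_rapidDecay ha |s|))) hu)
  have hsum : Summable fun l => ‖a (k - l)‖ * ‖u l‖ := summable_norm_mul_norm_apply ha hu k
  rw [Real.enorm_eq_ofReal (tsum_nonneg fun l => by positivity), ENNReal.ofReal_tsum_of_nonneg (fun l => by positivity) hsum]
  exact ENNReal.tsum_le_tsum fun l => by rw [ENNReal.ofReal_mul (norm_nonneg _), ofReal_norm, ofReal_norm]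

/-! ### Adjoint symbols and the adjoint of a multiplier -/

section Adjoint

variable [CompleteSpace V] [CompleteSpace W]

/-- The **adjoint symbol** `a†(k) = (a(-k))†` of an operator-valued coefficient family (for the
coefficients of a matrix function `ω` on `T^d`, the coefficients of the pointwise adjoint `ω(x)†`).
[cite: WarnerGTM94, 6.24 (3)] -/
def adjSymb (a : (d → ℤ) → (V →L[ℂ] W)) : (d → ℤ) → (W →L[ℂ] V) := fun k => ContinuousLinearMap.adjoint (a (-k))

omit [Fintype d] in
/-- Unfolding of `adjSymb`. [folklore] -/
@[simp] theorem adjSymb_apply (a : (d → ℤ) → (V →L[ℂ] W)) (k : d → ℤ) :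
    adjSymb a k = ContinuousLinearMap.adjoint (a (-k)) := rfl

omit [Fintype d] in
/-- `a†† = a`. [folklore] -/
theorem adjSymb_adjSymb (a : (d → ℤ) → (V →L[ℂ] W)) : adjSymb (adjSymb a) = a := by
  funext k; simp [adjSymb]

/-- The adjoint symbol is rapidly decreasing with `a` (`‖T†‖ = ‖T‖`). [folklore] -/
theorem _root_.Literature.Analysis.FunctionSpaces.Torus.RapidDecay.adjSymb {a : (d → ℤ) → (V →L[ℂ] W)}
    (ha : RapidDecay a) : RapidDecay (Lattice.adjSymb a) := by
  intro m
  refine ((Equiv.neg (d → ℤ)).summable_iff.2 (ha m)).congr fun k => ?_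
  simp only [Function.comp_apply, Equiv.neg_apply, freqNormSq_neg, Lattice.adjSymb_apply,
    LinearIsometryEquiv.norm_map]

/-- **The adjoint of a multiplier** (Warner 6.24 (5) for order zero, 6.18 (j) (9)):
`⟨a ⋆ u, v⟩ = ⟨u, a† ⋆ v⟩` for `u ∈ H_s` and `v ∈ H_{-s}` (Fubini for the absolutely convergent double
series `∑_k ∑_l ⟪a(k-l) u_l, v_k⟫`, and `⟪a(k-l)u_l, v_k⟫ = ⟪u_l, a(k-l)† v_k⟫`).
[cite: WarnerGTM94, 6.24 (5)] -/
theorem pairing_conv_left {a : (d → ℤ) → (V →L[ℂ] W)} (ha : RapidDecay a) {s : ℝ} {u : (d → ℤ) → V}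
    {v : (d → ℤ) → W} (hu : eNormSq s u < ∞) (hv : eNormSq (-s) v < ∞) :
    pairing (conv a u) v = pairing u (conv (adjSymb a) v) := by
  have hut : Tempered u := ⟨s, hu⟩
  have hvt : Tempered v := ⟨-s, hv⟩
  -- the double family and its absolute summability
  obtain ⟨F, hF⟩ : ∃ F : (d → ℤ) × (d → ℤ) → ℂ, ∀ p, F p = ⟪a (p.1 - p.2) (u p.2), v p.1⟫_ℂ := ⟨_, fun _ => rfl⟩
  obtain ⟨N, hN⟩ : ∃ N : (d → ℤ) → ℝ, ∀ k, N k = ∑' l, ‖a (k - l)‖ * ‖u l‖ := ⟨_, fun _ => rfl⟩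
  have hNs : eNormSq s N < ∞ := by
    have := eNormSq_tsum_norm_mul_norm_lt_top ha hu
    convert this using 2; funext k; exact hN k
  have hinner : ∀ k, Summable fun l => ‖a (k - l)‖ * ‖u l‖ := fun k => summable_norm_mul_norm_apply ha hu k
  have hG : Summable fun p : (d → ℤ) × (d → ℤ) => ‖a (p.1 - p.2)‖ * ‖u p.2‖ * ‖v p.1‖ := by
    have hfib : ∀ k, Summable fun l => ‖a (k - l)‖ * ‖u l‖ * ‖v k‖ := fun k => (hinner k).mul_right _
    have hsum : Summable fun k => ∑' l, ‖a (k - l)‖ * ‖u l‖ * ‖v k‖ := by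
      have h := (summable_norm_mul_norm (s := s) (u := N) (v := v) hNs hv).1
      refine h.congr fun k => ?_
      rw [tsum_mul_right, hN, Real.norm_of_nonneg (tsum_nonneg fun l => by positivity)]
    exact (summable_prod_of_nonneg fun p => by positivity).2 ⟨hfib, hsum⟩
  have hFs : Summable F := Summable.of_norm (hG.of_nonneg_of_le (fun p => norm_nonneg _) fun p => by
    rw [hF]
    exact (norm_inner_le_norm _ _).trans (mul_le_mul_of_nonneg_right ((a _).le_opNorm _) (norm_nonneg _)))
  -- left-hand side
  have hL : pairing (conv a u) v = ∑' k, ∑' l, F (k, l) := by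
    rw [pairing]
    refine tsum_congr fun k => ?_
    rw [conv_apply, inner_tsum_left (summable_conv_term ha hut k)]
    exact tsum_congr fun l => (hF (k, l)).symm
  -- right-hand side
  have hR : pairing u (conv (adjSymb a) v) = ∑' l, ∑' k, F (k, l) := by
    rw [pairing]
    refine tsum_congr fun l => ?_
    rw [conv_apply, inner_tsum_right _ (summable_conv_term ha.adjSymb hvt l)]
    refine tsum_congr fun k => ?_
    rw [hF, adjSymb_apply, neg_sub, ContinuousLinearMap.adjoint_inner_right]
  rw [hL, hR]
  have hunc : Summable (Function.uncurry fun k l => F (k, l)) := hFs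
  exact (hunc.tsum_comm' (fun k => hFs.prod_factor k) fun l => hFs.prod_symm.prod_factor l).symm

/-- The symmetric form: `⟨u, a ⋆ v⟩ = ⟨a† ⋆ u, v⟩`. [cite: WarnerGTM94, 6.24 (5)] -/
theorem pairing_conv_right {a : (d → ℤ) → (W →L[ℂ] V)} (ha : RapidDecay a) {s : ℝ} {u : (d → ℤ) → V}
    {v : (d → ℤ) → W} (hu : eNormSq s u < ∞) (hv : eNormSq (-s) v < ∞) :
    pairing u (conv a v) = pairing (conv (adjSymb a) u) v := by
  have h := pairing_conv_left (a := adjSymb a) ha.adjSymb hu hv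
  rw [adjSymb_adjSymb] at h
  exact h.symm

omit [Fintype d] [CompleteSpace V] [CompleteSpace W] in
/-- **The adjoint of a derivative**: `⟨∂_j u, v⟩ = -⟨u, ∂_j v⟩` (unconditionally; `conj(2πi k_j) = -2πi k_j`).
[cite: WarnerGTM94, 6.24 (3)] -/
theorem pairing_freqDeriv_left (j : d) (u v : (d → ℤ) → V) : pairing (freqDeriv j u) v = -pairing u (freqDeriv j v) := by
  rw [pairing, pairing, ← tsum_neg]
  refine tsum_congr fun k => ?_
  rw [freqDeriv_apply, freqDeriv_apply, inner_smul_left, inner_smul_right, ← neg_mul]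
  congr 1
  simp only [map_mul, Complex.conj_ofReal, Complex.conj_I, map_intCast, map_ofNat]
  ring

end Adjoint

end Lattice

end Literature.Analysis.FunctionSpaces
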